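import Summits.AtomisticToContinuum.HydrodynamicLimit.Theses.InformationPercolationEngine
import Summits.AtomisticToContinuum.HydrodynamicLimit.Theorems.InformationPercolationEngineKineticClosureBridge
import Literature.Analysis.FluidPDE.HardSphereCollisionEnumeration
import Literature.Analysis.FluidPDE.HardSphereDynamicsProofs
import HarnessLib

/-!
# Collision invariance of the normalised collision functional (crux `ChaosClosesEuler`,
stmt-AtomisticToContinuum-15141, line `Sketch`, stub `stub_collisionInvariance`)

WHAT. The registered stub `stub_collisionInvariance` of the line `Sketch` on the crux
`InformationPercolationEngine.ChaosClosesEuler`: along ONE good orbit `γ s = Φ.flow s z` of the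
hard-sphere flow on `𝕋³` at fixed reduced density (`ε = hsDiameter σ N`, `0 < ε ≤ σ < 1/2`), the
route's normalised empirical collision functional
`K_N[F] = ε/(N+1) · Σ_{collision times s ∈ [0,τ]} Σ_{ordered contact pairs (i,j)} F`
applied to the jump observable `F = χ(s, xᵢ) (ψ(vᵢ⁺) − ψ(vᵢ⁻))` (`χ` bounded and Lipschitz in
space-time, `ψ` bounded) is `O(ε)`, DETERMINISTICALLY:
`|K_N[χ(ψ(v⁺) − ψ(v⁻))]| ≤ ε‖ψ‖∞ (2‖χ‖∞ + Lip(χ) τ (3/2 + E/(N+1)))`, `E` the (conserved) kinetic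
energy. This is the finite-`N`, pathwise form of Bogolyubov's exact weak equation for the
empirical measure of one hard-sphere trajectory (the collision term tested against a collision
invariant of ONE particle telescopes along that particle's history).

PROOF. At a collision time exactly one unordered pair `{p, q}` is in contact
(`IsHardSphereTrajectory.contactPairs_eq_pair`); for both ordered pairs the recorded
pre-collisional velocity `(reflectVel n (vᵢ, vⱼ)).1` is the velocity of `i` in the left limit
`leftLim γ s` (`leftLim_eq_collidePair`, `collidePair_apply_left`), and non-participants do not
jump (`collidePair_apply_of_ne`), so the ordered-pair sum at time `s` is
`Σᵢ χ(s, xᵢ(s)) (ψ(vᵢ(s)) − ψ(vᵢ(s⁻)))` over ALL particles (`pairSum_eq_particleSum`). Listing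
the finitely many collision times of `[0, τ]` increasingly (`nthCollisionTime_enum` from an origin
`a < 0` with `(a, 0)` collision-free), velocities are constant and positions move by free flight
between consecutive times (`leftLim_eq_freeFlight`, `leftLim_apply_fst`), so per particle the sum
is a discrete Stieltjes sum `Σ_c g(t_c) (f_c − f_{c−1})`, bounded after Abel summation
(`abel_identity`, `abel_bound`) by `2‖χ‖‖ψ‖ + ‖ψ‖ Lip(χ) Σ_c Δt_c (1 + ‖vᵢ(t_c)‖)` (minimal-image
displacement `≤ Δt ‖v‖`, `Torus.norm_reprSym_proj_le`). Summing over particles,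
`Σᵢ ‖vᵢ‖ ≤ (N+1)/2 + E` (`sum_norm_vel_le`) with `E` conserved
(`IsHardSphereTrajectory.configEnergy_eq_holds`) and `Σ_c Δt_c ≤ τ` give the bound.

REFERENCES. N. N. Bogolyubov, *Microscopic solutions of the Boltzmann–Enskog equation in kinetic
theory for elastic balls*, Theor. Math. Phys. 24 (1975) 804–807; M. Pulvirenti, S. Simonella,
*On the evolution of the empirical measure for the hard-sphere dynamics*, arXiv:1504.03215, §3
Thm 1 (exact weak equation for the empirical measure of one hard-sphere trajectory).
-/

noncomputable section

namespace Summit.AtomisticToContinuum.HydrodynamicLimit.Theorems.ChaosClosesEulerCollisionInvariance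

open scoped BigOperators Topology Classical MeasureTheory ENNReal InnerProductSpace
open Filter Set MeasureTheory
open Literature.MathematicalPhysics.KineticTheory
open Literature.Analysis.FluidPDE

/-! ## §1 Discrete Abel summation -/

/-- **Abel summation identity** for a Stieltjes-type sum `Σ_{c ≤ M} g_c (f_c − f⁻_c)` whose
"previous values" satisfy `f⁻_{c+1} = f_c` (`c < M`):
`Σ_{c ≤ M} g_c (f_c − f⁻_c) = g_M f_M − g_0 f⁻_0 − Σ_{c < M} (g_{c+1} − g_c) f_c`. [folklore] -/
theorem abel_identity (g f fpre : ℕ → ℝ) (M : ℕ) (hpre : ∀ c, c < M → fpre (c + 1) = f c) :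
    ∑ c ∈ Finset.range (M + 1), g c * (f c - fpre c) =
      g M * f M - g 0 * fpre 0 - ∑ c ∈ Finset.range M, (g (c + 1) - g c) * f c := by
  induction M with
  | zero => rw [Finset.sum_range_one, Finset.sum_range_zero]; ring
  | succ M ih =>
    rw [Finset.sum_range_succ, ih fun c hc => hpre c (hc.trans M.lt_succ_self), Finset.sum_range_succ,
      hpre M M.lt_succ_self]
    ring

/-- **Abel summation bound**: with `|g| ≤ A`, `|f|, |f⁻_0| ≤ B` and increments
`|g_{c+1} − g_c| ≤ L Δt_c (1 + w_c)`, the Stieltjes-type sum is at most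
`2AB + B L Σ_{c<M} Δt_c (1 + w_c)`. [folklore] -/
theorem abel_bound (g f fpre t w : ℕ → ℝ) {A B L : ℝ} (hB : 0 ≤ B) (M : ℕ)
    (hpre : ∀ c, c < M → fpre (c + 1) = f c)
    (hg : ∀ c, |g c| ≤ A) (hf : ∀ c, |f c| ≤ B) (hfpre : |fpre 0| ≤ B)
    (hinc : ∀ c, c < M → |g (c + 1) - g c| ≤ L * ((t (c + 1) - t c) * (1 + w c))) :
    |∑ c ∈ Finset.range (M + 1), g c * (f c - fpre c)| ≤
      2 * A * B + B * (L * ∑ c ∈ Finset.range M, (t (c + 1) - t c) * (1 + w c)) := by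
  rw [abel_identity g f fpre M hpre]
  have h1 : |g M * f M| ≤ A * B := by
    rw [abs_mul]
    exact mul_le_mul (hg M) (hf M) (abs_nonneg _) ((abs_nonneg _).trans (hg M))
  have h2 : |g 0 * fpre 0| ≤ A * B := by
    rw [abs_mul]
    exact mul_le_mul (hg 0) hfpre (abs_nonneg _) ((abs_nonneg _).trans (hg 0))
  have h3 : |∑ c ∈ Finset.range M, (g (c + 1) - g c) * f c| ≤
      ∑ c ∈ Finset.range M, B * (L * ((t (c + 1) - t c) * (1 + w c))) := by
    refine (Finset.abs_sum_le_sum_abs _ _).trans (Finset.sum_le_sum fun c hc => ?_)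
    have hc' := Finset.mem_range.1 hc
    rw [abs_mul, mul_comm]
    exact mul_le_mul (hf c) (hinc c hc') (abs_nonneg _) hB
  rw [← Finset.mul_sum, ← Finset.mul_sum] at h3
  have h12 : |g M * f M - g 0 * fpre 0| ≤ A * B + A * B := (abs_sub _ _).trans (add_le_add h1 h2)
  have h123 := (abs_sub (g M * f M - g 0 * fpre 0) _).trans (add_le_add h12 h3)
  linarith

/-! ## §2 Elementary kinematics -/

/-- `Σᵢ ‖vᵢ‖ ≤ n/2 + E(w)`: each speed is at most `(1 + ‖v‖²)/2`. [folklore] -/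
theorem sum_norm_vel_le {n : ℕ} (w : Config n (Fin 3) T3) :
    ∑ i, ‖(w i).2‖ ≤ (n : ℝ) / 2 + configEnergy w := by
  have hpt : ∀ i : Fin n, ‖(w i).2‖ ≤ 1 / 2 + 2⁻¹ * ‖(w i).2‖ ^ 2 := fun i => by
    nlinarith [sq_nonneg (‖(w i).2‖ - 1), norm_nonneg (w i).2]
  calc ∑ i, ‖(w i).2‖ ≤ ∑ i : Fin n, (1 / 2 + 2⁻¹ * ‖(w i).2‖ ^ 2) :=
        Finset.sum_le_sum fun i _ => hpt i
    _ = (n : ℝ) / 2 + configEnergy w := by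
        rw [Finset.sum_add_distrib, Finset.sum_const, Finset.card_univ, Fintype.card_fin, nsmul_eq_mul,
          configEnergy, Finset.mul_sum]
        ring

/-- On the flat torus a translate `x + proj w` is within minimal-image distance `‖w‖` of `x`.
[folklore] -/
theorem euclidDist_translate_self_le (x : T3) (w : V3) :
    Torus.euclidDist ((Torus.geometry (Fin 3)).translate x w) x ≤ ‖w‖ := by
  rw [Torus.geometry_translate, Torus.euclidDist_eq, add_sub_cancel_left]
  exact Torus.norm_reprSym_proj_le w

/-! ## §3 The ordered-pair sum at a collision time is a sum over all particles -/

/-- **Bogolyubov's bookkeeping at one collision.** At a collision time `s` of a hard-sphere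
trajectory in a regular geometry (Hausdorff position space), for every weight `a` and every
`ψ`, the route's ordered-contact-pair sum of `aᵢ (ψ(vᵢ) − ψ((reflectVel (xᵢ − xⱼ) (vᵢ, vⱼ)).1))`
equals `Σᵢ aᵢ (ψ(vᵢ(s)) − ψ(vᵢ(s⁻)))` over ALL particles: the two ordered pairs `(p, q), (q, p)`
of the unique colliding pair carry the jumps of `p` and of `q` (the recorded pre-collisional
velocity is the left limit), and no other particle jumps. [folklore] -/
theorem pairSum_eq_particleSum {d : Type*} [Fintype d] {X : Type*} [TopologicalSpace X] [T2Space X]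
    {n : ℕ} {G : Geometry d X} {ε : ℝ} {γ : ℝ → Config n d X} (h : IsHardSphereTrajectory G ε n γ)
    (hG : G.IsHardSphereRegular ε) {s : ℝ} (hs : s ∈ collisionTimes G ε γ) (a : Fin n → ℝ)
    (ψ : EuclideanSpace ℝ d → ℝ) :
    (∑ i, ∑ j, if i ≠ j ∧ ‖G.sepVec (γ s i).1 (γ s j).1‖ = ε then
        a i * (ψ (γ s i).2 - ψ (reflectVel (G.sepVec (γ s i).1 (γ s j).1) ((γ s i).2, (γ s j).2)).1)
      else 0) =
      ∑ i, a i * (ψ (γ s i).2 - ψ (Function.leftLim γ s i).2) := by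
  obtain ⟨⟨p, q⟩, hpq⟩ := mem_collisionTimes_iff_contactPairs_nonempty.1 hs
  have hne : p ≠ q := (mem_contactPairs.1 hpq).1
  have hc : γ s ∈ contactSet G n ε p q := (mem_contactPairs.1 hpq).2
  have hqp : (q, p) ∈ contactPairs G ε (γ s) := (swap_mem_contactPairs_iff hG).2 hpq
  have hc' : γ s ∈ contactSet G n ε q p := (mem_contactPairs.1 hqp).2
  have hL : Function.leftLim γ s = collidePair G p q (γ s) := h.leftLim_eq_collidePair hne hc
  have hL' : Function.leftLim γ s = collidePair G q p (γ s) := h.leftLim_eq_collidePair hne.symm hc'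
  have hne2 : ((p, q) : Fin n × Fin n) ≠ (q, p) := fun heq => hne (Prod.mk.inj heq).1
  rw [← sum_contactPairs_eq (h.mem s), h.contactPairs_eq_pair hG hpq, Finset.sum_pair hne2]
  have hrest : ∀ k, k ≠ p ∧ k ≠ q → a k * (ψ (γ s k).2 - ψ (Function.leftLim γ s k).2) = 0 :=
    fun k hk => by rw [hL, collidePair_apply_of_ne hk.1 hk.2, sub_self, mul_zero]
  rw [Fintype.sum_eq_add p q hne hrest]
  congr 1
  · rw [hL, collidePair_apply_left hne]
  · rw [hL', collidePair_apply_left hne.symm]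

/-! ## §4 The bound along one hard-sphere trajectory -/

/-- **Collision invariance, pathwise, along a hard-sphere trajectory.** For a hard-sphere
trajectory `γ` of `N + 1` spheres of diameter `ε > 0` in a regular geometry `G` on `𝕋³` whose
translates satisfy `d(x + w, x) ≤ ‖w‖` (true for `Torus.geometry`), a bounded space-time
Lipschitz weight `χ` and a bounded `ψ`:
`|ε/(N+1) Σ_{s ∈ collisions ∩ [0,τ]} Σ_{(i,j) in contact} χ(s,xᵢ)(ψ(vᵢ) − ψ(vᵢ⁻))|
≤ ε Cψ (2Cχ + Lχ τ (3/2 + E(γ 0)/(N+1)))` (Abel summation per particle, energy conservation).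
[folklore] -/
theorem collisionInvariance_of_trajectory {N : ℕ} {G : Geometry (Fin 3) T3} {ε : ℝ} (hε : 0 < ε)
    (hG : G.IsHardSphereRegular ε)
    (hdist : ∀ (x : T3) (w : V3), Torus.euclidDist (G.translate x w) x ≤ ‖w‖)
    {γ : ℝ → Config (N + 1) (Fin 3) T3} (h : IsHardSphereTrajectory G ε (N + 1) γ)
    {z : Config (N + 1) (Fin 3) T3} (h0 : γ 0 = z) {τ : ℝ} (hτ : 0 < τ)
    {χ : ℝ × T3 → ℝ} {Cχ Lχ : ℝ} (hCχ : 0 ≤ Cχ) (hLχ : 0 ≤ Lχ) (hχb : ∀ p, |χ p| ≤ Cχ)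
    (hχL : ∀ (s s' : ℝ) (x x' : T3), |χ (s, x) - χ (s', x')| ≤ Lχ * (|s - s'| + Torus.euclidDist x x'))
    {ψ : V3 → ℝ} {Cψ : ℝ} (hCψ : 0 ≤ Cψ) (hψb : ∀ v, |ψ v| ≤ Cψ) :
    |ε / (N + 1 : ℝ) * ∑ᶠ (s : ℝ) (_ : s ∈ collisionTimes G ε γ ∩ Set.Icc 0 τ),
        ∑ i : Fin (N + 1), ∑ j : Fin (N + 1),
          (if i ≠ j ∧ ‖G.sepVec (γ s i).1 (γ s j).1‖ = ε then
            χ (s, (γ s i).1) * (ψ (γ s i).2 - ψ (reflectVel (G.sepVec (γ s i).1 (γ s j).1) ((γ s i).2, (γ s j).2)).1)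
          else 0)|
      ≤ ε * Cψ * (2 * Cχ + Lχ * τ * (3 / 2 + configEnergy z / (N + 1 : ℝ))) := by
  have hGt : ∀ x : T3, Continuous (G.translate x) := fun x =>
    hG.continuous_translate.comp (continuous_const.prodMk continuous_id)
  have hE0 : 0 ≤ configEnergy z := by unfold configEnergy; positivity
  have hN : (0 : ℝ) < N + 1 := by positivity
  have hN' : (N : ℝ) + 1 ≠ 0 := hN.ne'
  have hfin : (collisionTimes G ε γ ∩ Icc 0 τ).Finite := h.locFinite 0 τ
  -- Step 1: the ordered-pair sum at each collision time is a sum over all particles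
  have hstep1 : (∑ s ∈ hfin.toFinset, ∑ i : Fin (N + 1), ∑ j : Fin (N + 1),
        (if i ≠ j ∧ ‖G.sepVec (γ s i).1 (γ s j).1‖ = ε then
          χ (s, (γ s i).1) * (ψ (γ s i).2 -
            ψ (reflectVel (G.sepVec (γ s i).1 (γ s j).1) ((γ s i).2, (γ s j).2)).1)
        else 0)) =
      ∑ s ∈ hfin.toFinset, ∑ i, χ (s, (γ s i).1) * (ψ (γ s i).2 - ψ (Function.leftLim γ s i).2) :=
    Finset.sum_congr rfl fun s hs =>
      pairSum_eq_particleSum h hG (hfin.mem_toFinset.1 hs).1 (fun i => χ (s, (γ s i).1)) ψ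
  -- Step 2: per-particle Abel bound and the summed increment bound
  obtain ⟨Q, hQJ, hQsum⟩ : ∃ Q : Fin (N + 1) → ℝ,
      (∀ i, |∑ s ∈ hfin.toFinset, χ (s, (γ s i).1) * (ψ (γ s i).2 - ψ (Function.leftLim γ s i).2)| ≤
        2 * Cχ * Cψ + Cψ * (Lχ * Q i)) ∧
      ∑ i, Q i ≤ τ * ((N + 1 : ℝ) * (3 / 2) + configEnergy z) := by
    by_cases hT : hfin.toFinset.Nonempty
    swap
    · refine ⟨fun _ => 0, fun i => ?_, ?_⟩
      · rw [Finset.not_nonempty_iff_eq_empty.1 hT, Finset.sum_empty, abs_zero]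
        positivity
      · rw [Finset.sum_const_zero]
        positivity
    -- the increasing enumeration of the collision times of `[0, τ]`
    have hsmaxT : hfin.toFinset.max' hT ∈ collisionTimes G ε γ ∩ Icc 0 τ :=
      hfin.mem_toFinset.1 (Finset.max'_mem _ hT)
    obtain ⟨a, ha0, hafree⟩ := h.exists_Ioo_left_free 0
    have hasmax : a < hfin.toFinset.max' hT := ha0.trans_le hsmaxT.2.1
    obtain ⟨m, hm_eq, hm_mem, hm_mono, hm_surj⟩ := h.nthCollisionTime_enum hsmaxT.1 hasmax
    set t := nthCollisionTime G ε γ a with ht_def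
    have ht_nonneg : ∀ n, n ≤ m → 0 ≤ t n := fun n hn => by
      by_contra hneg
      exact hafree (t n) ⟨(hm_mem n hn).2.1, lt_of_not_ge hneg⟩ (hm_mem n hn).1
    have ht_le : ∀ n, n ≤ m → t n ≤ τ := fun n hn => (hm_mem n hn).2.2.trans hsmaxT.2.2
    have ht_lt : ∀ c, c < m → t c < t (c + 1) := fun c hc =>
      hm_mono (Set.mem_Iic.2 hc.le) (Set.mem_Iic.2 (Nat.succ_le_of_lt hc)) c.lt_succ_self
    have ht_free : ∀ c, ∀ u ∈ Ioo (t c) (t (c + 1)), u ∉ collisionTimes G ε γ := fun c u hu =>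
      h.not_mem_collisionTimes_of_mem_Ioo_nthCollisionTime_succ hu
    have hTimage : hfin.toFinset = (Finset.range (m + 1)).image t := by
      ext u
      rw [hfin.mem_toFinset, Finset.mem_image]
      constructor
      · intro hu
        have hule : u ≤ hfin.toFinset.max' hT := hfin.toFinset.le_max' u (hfin.mem_toFinset.2 hu)
        obtain ⟨n, hn, hnu⟩ := hm_surj u ⟨hu.1, ha0.trans_le hu.2.1, hule⟩
        exact ⟨n, Finset.mem_range.2 (Nat.lt_succ_of_le hn), hnu⟩
      · rintro ⟨n, hn, rfl⟩
        have hn' : n ≤ m := Nat.le_of_lt_succ (Finset.mem_range.1 hn)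
        exact ⟨(hm_mem n hn').1, ht_nonneg n hn', ht_le n hn'⟩
    have hinj : Set.InjOn t ↑(Finset.range (m + 1)) := hm_mono.injOn.mono fun n hn =>
      Set.mem_Iic.2 (Nat.le_of_lt_succ (Finset.mem_range.1 (Finset.mem_coe.1 hn)))
    -- kinematics between consecutive collision times
    have hleft : ∀ c, c < m → Function.leftLim γ (t (c + 1)) = freeFlight G (t (c + 1) - t c) (γ (t c)) :=
      fun c hc => h.leftLim_eq_freeFlight hGt (ht_lt c hc) (ht_free c)
    have hvel : ∀ c, c < m → ∀ i, (Function.leftLim γ (t (c + 1)) i).2 = (γ (t c) i).2 :=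
      fun c hc i => by rw [hleft c hc, freeFlight_apply]
    have hpos : ∀ c, c < m → ∀ i,
        (γ (t (c + 1)) i).1 = G.translate (γ (t c) i).1 ((t (c + 1) - t c) • (γ (t c) i).2) :=
      fun c hc i => by rw [← h.leftLim_apply_fst hGt (t (c + 1)) i, hleft c hc, freeFlight_apply]
    have hEt : ∀ c, configEnergy (γ (t c)) = configEnergy z := fun c => by
      rw [← h0]
      exact IsHardSphereTrajectory.configEnergy_eq_holds h _ _
    refine ⟨fun i => ∑ c ∈ Finset.range m, (t (c + 1) - t c) * (1 + ‖(γ (t c) i).2‖), fun i => ?_, ?_⟩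
    · -- per-particle Abel bound
      rw [hTimage, Finset.sum_image hinj]
      refine abel_bound (fun c => χ (t c, (γ (t c) i).1)) (fun c => ψ (γ (t c) i).2)
        (fun c => ψ (Function.leftLim γ (t c) i).2) t (fun c => ‖(γ (t c) i).2‖) hCψ m ?_
        (fun c => hχb _) (fun c => hψb _) (hψb _) ?_
      · intro c hc
        show ψ (Function.leftLim γ (t (c + 1)) i).2 = ψ (γ (t c) i).2
        rw [hvel c hc i]
      · intro c hc
        show |χ (t (c + 1), (γ (t (c + 1)) i).1) - χ (t c, (γ (t c) i).1)| ≤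
          Lχ * ((t (c + 1) - t c) * (1 + ‖(γ (t c) i).2‖))
        have hΔ : 0 ≤ t (c + 1) - t c := sub_nonneg.2 (ht_lt c hc).le
        calc |χ (t (c + 1), (γ (t (c + 1)) i).1) - χ (t c, (γ (t c) i).1)|
            ≤ Lχ * (|t (c + 1) - t c| + Torus.euclidDist (γ (t (c + 1)) i).1 (γ (t c) i).1) :=
              hχL _ _ _ _
          _ ≤ Lχ * ((t (c + 1) - t c) + ‖(t (c + 1) - t c) • (γ (t c) i).2‖) := by
              rw [abs_of_nonneg hΔ, hpos c hc i]
              exact mul_le_mul_of_nonneg_left (add_le_add le_rfl (hdist _ _)) hLχ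
          _ = Lχ * ((t (c + 1) - t c) * (1 + ‖(γ (t c) i).2‖)) := by
              rw [norm_smul, Real.norm_eq_abs, abs_of_nonneg hΔ]
              ring
    · -- the summed increments: exchange the sums, bound the speeds by the energy
      rw [Finset.sum_comm]
      have hinner : ∀ c ∈ Finset.range m,
          ∑ i : Fin (N + 1), (t (c + 1) - t c) * (1 + ‖(γ (t c) i).2‖) ≤
            (t (c + 1) - t c) * ((N + 1 : ℝ) * (3 / 2) + configEnergy z) := fun c hc => by
        rw [← Finset.mul_sum]
        refine mul_le_mul_of_nonneg_left ?_ (sub_nonneg.2 (ht_lt c (Finset.mem_range.1 hc)).le)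
        rw [Finset.sum_add_distrib, Finset.sum_const, Finset.card_univ, Fintype.card_fin, nsmul_eq_mul,
          mul_one]
        have hv := sum_norm_vel_le (γ (t c))
        rw [hEt c] at hv
        push_cast at hv ⊢
        linarith
      calc ∑ c ∈ Finset.range m, ∑ i : Fin (N + 1), (t (c + 1) - t c) * (1 + ‖(γ (t c) i).2‖)
          ≤ ∑ c ∈ Finset.range m, (t (c + 1) - t c) * ((N + 1 : ℝ) * (3 / 2) + configEnergy z) :=
            Finset.sum_le_sum hinner
        _ = (t m - t 0) * ((N + 1 : ℝ) * (3 / 2) + configEnergy z) := by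
            rw [← Finset.sum_mul, Finset.sum_range_sub]
        _ ≤ τ * ((N + 1 : ℝ) * (3 / 2) + configEnergy z) := by
            have h1 : t m - t 0 ≤ τ := by linarith [ht_le m le_rfl, ht_nonneg 0 (Nat.zero_le m)]
            have h2 : 0 ≤ (N + 1 : ℝ) * (3 / 2) + configEnergy z := by positivity
            exact mul_le_mul_of_nonneg_right h1 h2
  -- Step 3: assemble
  rw [finsum_mem_eq_finite_toFinset_sum _ hfin, hstep1, Finset.sum_comm, abs_mul,
    abs_of_pos (div_pos hε hN)]
  have hsum : |∑ i : Fin (N + 1), ∑ s ∈ hfin.toFinset,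
        χ (s, (γ s i).1) * (ψ (γ s i).2 - ψ (Function.leftLim γ s i).2)| ≤
      (N + 1 : ℝ) * (2 * Cχ * Cψ) + Cψ * (Lχ * (τ * ((N + 1 : ℝ) * (3 / 2) + configEnergy z))) := by
    calc |∑ i : Fin (N + 1), ∑ s ∈ hfin.toFinset,
            χ (s, (γ s i).1) * (ψ (γ s i).2 - ψ (Function.leftLim γ s i).2)|
        ≤ ∑ i : Fin (N + 1), |∑ s ∈ hfin.toFinset,
            χ (s, (γ s i).1) * (ψ (γ s i).2 - ψ (Function.leftLim γ s i).2)| :=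
          Finset.abs_sum_le_sum_abs _ _
      _ ≤ ∑ i : Fin (N + 1), (2 * Cχ * Cψ + Cψ * (Lχ * Q i)) := Finset.sum_le_sum fun i _ => hQJ i
      _ = (N + 1 : ℝ) * (2 * Cχ * Cψ) + Cψ * (Lχ * ∑ i, Q i) := by
          rw [Finset.sum_add_distrib, Finset.sum_const, Finset.card_univ, Fintype.card_fin, nsmul_eq_mul,
            ← Finset.mul_sum, ← Finset.mul_sum]
          push_cast
          ring
      _ ≤ (N + 1 : ℝ) * (2 * Cχ * Cψ) + Cψ * (Lχ * (τ * ((N + 1 : ℝ) * (3 / 2) + configEnergy z))) := by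
          gcongr
  calc ε / (N + 1 : ℝ) * |∑ i : Fin (N + 1), ∑ s ∈ hfin.toFinset,
          χ (s, (γ s i).1) * (ψ (γ s i).2 - ψ (Function.leftLim γ s i).2)|
      ≤ ε / (N + 1 : ℝ) *
          ((N + 1 : ℝ) * (2 * Cχ * Cψ) + Cψ * (Lχ * (τ * ((N + 1 : ℝ) * (3 / 2) + configEnergy z)))) :=
        mul_le_mul_of_nonneg_left hsum (div_pos hε hN).le
    _ = ε * Cψ * (2 * Cχ + Lχ * τ * (3 / 2 + configEnergy z / (N + 1 : ℝ))) := by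
        field_simp

/-! ## §5 The registered stub -/

/-- **STUB `stub_collisionInvariance` (line `Sketch`, crux `ChaosClosesEuler`, stmt-15141):
collision invariance of the normalised collision functional, pathwise on the good set.**
For a bounded `ψ` of the velocity and a bounded space-time Lipschitz localiser `χ`, the
`K_N`-functional of the jump `χ(s, xᵢ)(ψ(vᵢ⁺) − ψ(vᵢ⁻))` along one good orbit is `O(ε_N)`:
`≤ ε‖ψ‖(2‖χ‖ + Lip(χ) τ (3/2 + E/(N+1)))` (Bogolyubov's exact weak equation for the empirical
measure of one trajectory, as a deterministic Abel-summation bound; from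
`collisionInvariance_of_trajectory` with `Torus.isHardSphereRegular_geometry`,
`euclidDist_translate_self_le`, `HardSphereFlow.isTrajectory`, `HardSphereFlow.flow_zero`).
[folklore] -/
theorem stub_collisionInvariance :
    ∀ (σ : ℝ), 0 < σ → σ < 2⁻¹ → ∀ (N : ℕ)
    (Φ : HardSphereFlow (Torus.geometry (Fin 3)) (hsDiameter σ N) (N + 1)),
    ∀ z ∈ Φ.good, ∀ τ : ℝ, 0 < τ →
    ∀ (χ : ℝ × T3 → ℝ) (Cχ Lχ : ℝ), 0 ≤ Cχ → 0 ≤ Lχ → (∀ p, |χ p| ≤ Cχ) →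
      (∀ (s s' : ℝ) (x x' : T3), |χ (s, x) - χ (s', x')| ≤ Lχ * (|s - s'| + Torus.euclidDist x x')) →
    ∀ (ψ : V3 → ℝ) (Cψ : ℝ), 0 ≤ Cψ → (∀ v, |ψ v| ≤ Cψ) →
    let ε := hsDiameter σ N
    let G : Geometry (Fin 3) T3 := Torus.geometry (Fin 3)
    let γ : ℝ → Config (N + 1) (Fin 3) T3 := fun s => Φ.flow s z
    let pv : ℝ → Fin (N + 1) → Fin (N + 1) → V3 × V3 := fun s i j =>
      reflectVel (G.sepVec (γ s i).1 (γ s j).1) ((γ s i).2, (γ s j).2)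
    |ε / (N + 1 : ℝ) * ∑ᶠ (s : ℝ) (_ : s ∈ collisionTimes G ε γ ∩ Set.Icc 0 τ),
        ∑ i : Fin (N + 1), ∑ j : Fin (N + 1),
          (if i ≠ j ∧ ‖G.sepVec (γ s i).1 (γ s j).1‖ = ε then
            χ (s, (γ s i).1) * (ψ (γ s i).2 - ψ (pv s i j).1) else 0)|
      ≤ ε * Cψ * (2 * Cχ + Lχ * τ * (3 / 2 + configEnergy z / (N + 1 : ℝ))) := by
  intro σ hσ hσ2 N Φ z hz τ hτ χ Cχ Lχ hCχ hLχ hχb hχL ψ Cψ hCψ hψb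
  exact collisionInvariance_of_trajectory (hsDiameter_pos hσ N)
    (Torus.isHardSphereRegular_geometry ((hsDiameter_le hσ.le N).trans_lt hσ2))
    euclidDist_translate_self_le (Φ.isTrajectory z hz) (Φ.flow_zero z hz) hτ hCχ hLχ hχb hχL hCψ hψb

end Summit.AtomisticToContinuum.HydrodynamicLimit.Theorems.ChaosClosesEulerCollisionInvariance

end
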